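import Summits.KontsevichZagierPeriods.Zeta5Search.WedgeDictionary
import HarnessLib

/-!
# ζ(5) search — certificates: the dual summand `R_b` as a COMPLEX rational function and its partial fractions
(cell `pub-zeta5`, certifier 2, generation 2)

HONEST FRAMING: systematic search; no irrationality claim unless certified.

OUR work (Summit side; generic layer of the DECAY side). The canonical partial-fraction data
`c = pfData b` of the summand `R_b(t) = numPoly_b(t+1)/(t+1)_{b₀+1}^6` of the very-well-poised series (34)
(`WedgeDictionary.IsPFData`, an identity of functions `ℚ → ℚ` away from the poles) is transported to the
complex plane:

* `Rc b z = numPoly_b(z+1) / ∏_{i ≤ b₀} (z+1+i)^6` — the summand as a function `ℂ → ℂ`;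
* `numPoly_comp_eq_pfPoly` — the partial-fraction decomposition as a POLYNOMIAL identity in `ℚ[X]`
  (both sides agree at every non-negative rational, an infinite set);
* `Rc_eq_pf` — for `z ∈ ℂ` off the poles `−1, …, −(b₀+1)`:
  `Rc b z = Σ_{p ≤ b₀} Σ_{o<6} c_{o,p} / (z+p+1)^{o+1}`.

This is the input of the lattice-sum ("two heights") bound for the coefficients `W(b) = Σ_p c_{2,p}`,
`U(b) = Σ_p c_{4,p}` (`Certificates/EisensteinHeights.lean`): evaluating `R_b` on the horizontal lattice lines
`ℤ + iY` sees the analytic continuation, hence the exponential cancellation inside `Σ_p c_{o,p}` that any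
termwise (Cauchy-estimate) bound misses. Nothing here is specific to a ray.
-/

noncomputable section

open Finset Polynomial

namespace Summit.KontsevichZagierPeriods.Zeta5Search.DualPF

open Summit.KontsevichZagierPeriods.Zeta5Search.DualSeries
open Summit.KontsevichZagierPeriods.Zeta5Search.WedgeDictionary
open Literature.NumberTheory.Transcendental.BallRivoal (pfEval poch)

/-! ### The objects -/

/-- The summand of (34) as a complex rational function: `R_b(z) = numPoly_b(z+1) / ∏_{i ≤ b₀}(z+1+i)^6`. -/
def Rc (b : ℕ → ℤ) (z : ℂ) : ℂ :=
  aeval (z + 1) (numPoly b) / (∏ i ∈ range ((b 0).toNat + 1), (z + 1 + i)) ^ 6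

/-- The pole polynomial with the `p`-th factor removed: `E_p = ∏_{i ≤ b₀, i ≠ p} (X + i + 1)`. -/
def polePolyErase (n p : ℕ) : ℚ[X] := ∏ i ∈ (range (n + 1)).erase p, (X + C ((i : ℚ) + 1))

/-- The full pole polynomial `D = ∏_{i ≤ n} (X + i + 1)` (so that `D(t) = (t+1)_{n+1}`). -/
def polePoly (n : ℕ) : ℚ[X] := ∏ i ∈ range (n + 1), (X + C ((i : ℚ) + 1))

/-- The partial-fraction side as a polynomial: `Σ_{p,o} c_{o,p} (X+p+1)^{5−o} E_p^6`. -/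
def pfPoly (n : ℕ) (c : ℕ → ℕ → ℚ) : ℚ[X] :=
  ∑ p ∈ range (n + 1), ∑ o ∈ range 6, C (c o p) * (X + C ((p : ℚ) + 1)) ^ (5 - o) * polePolyErase n p ^ 6

/-! ### Evaluations over `ℚ` -/

/-- `D(t) = (t+1)_{n+1}`. -/
theorem eval_polePoly (n : ℕ) (t : ℚ) : (polePoly n).eval t = poch (t + 1) (n + 1) := by
  unfold polePoly poch
  rw [eval_prod]
  refine prod_congr rfl fun i _ => ?_
  rw [eval_add, eval_X, eval_C]
  ring

/-- `E_p(t) · (t+p+1) = (t+1)_{n+1}` for `p ≤ n`. -/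
theorem eval_polePolyErase_mul (n : ℕ) {p : ℕ} (hp : p ≤ n) (t : ℚ) :
    (polePolyErase n p).eval t * (t + p + 1) = poch (t + 1) (n + 1) := by
  rw [← eval_polePoly, polePolyErase, polePoly, eval_prod, eval_prod]
  have hmem : p ∈ range (n + 1) := mem_range.2 (Nat.lt_succ_of_le hp)
  rw [← prod_erase_mul _ _ hmem, eval_add, eval_X, eval_C]
  ring

/-- At a non-pole rational `t`, `pfPoly(t) = (t+1)_{n+1}^6 · pfEval n 6 c t`. -/
theorem eval_pfPoly (n : ℕ) (c : ℕ → ℕ → ℚ) (t : ℚ) (ht : ∀ p, p ≤ n → t + p + 1 ≠ 0) :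
    (pfPoly n c).eval t = poch (t + 1) (n + 1) ^ 6 * pfEval n 6 c t := by
  unfold pfPoly pfEval
  rw [eval_finsetSum, mul_sum]
  refine sum_congr rfl fun p hp => ?_
  have hpn : p ≤ n := Nat.lt_succ_iff.1 (mem_range.1 hp)
  rw [eval_finsetSum, mul_sum]
  refine sum_congr rfl fun o ho => ?_
  have ho6 : o < 6 := mem_range.1 ho
  rw [eval_mul, eval_mul, eval_C, eval_pow, eval_pow, eval_add, eval_X, eval_C,
    ← eval_polePolyErase_mul n hpn t]
  have hu : (t + p + 1 : ℚ) ≠ 0 := ht p hpn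
  have hsplit : ((polePolyErase n p).eval t * (t + p + 1)) ^ 6 =
      (polePolyErase n p).eval t ^ 6 * ((t + p + 1) ^ (o + 1) * (t + p + 1) ^ (5 - o)) := by
    rw [mul_pow, ← pow_add, show o + 1 + (5 - o) = 6 by omega]
  rw [hsplit]
  field_simp
  ring

/-! ### The polynomial identity -/

/-- **Partial fractions as a polynomial identity**: for partial-fraction data `c` of `R_b` (`IsPFData b c`),
`numPoly_b(X+1) = Σ_{p,o} c_{o,p} (X+p+1)^{5−o} E_p^6` in `ℚ[X]`. -/
theorem numPoly_comp_eq_pfPoly {b : ℕ → ℤ} {c : ℕ → ℕ → ℚ} (hc : IsPFData b c) :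
    (numPoly b).comp (X + C 1) = pfPoly (b 0).toNat c := by
  set n := (b 0).toNat with hn
  -- the difference vanishes at every non-negative rational
  have hroot : ∀ t : ℚ, 0 ≤ t → ((numPoly b).comp (X + C 1) - pfPoly n c).IsRoot t := by
    intro t ht0
    have ht : ∀ p, p ≤ n → t + p + 1 ≠ 0 := fun p _ => by positivity
    have hpoch : poch (t + 1) (n + 1) ≠ 0 := by
      rw [← eval_polePoly, polePoly, eval_prod]
      exact prod_ne_zero_iff.2 fun i _ => by rw [eval_add, eval_X, eval_C]; positivity
    rw [IsRoot, eval_sub, eval_pfPoly n c t ht, hc t ht, ← hn, sub_eq_zero]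
    field_simp
  have hinf : Set.Infinite {t : ℚ | ((numPoly b).comp (X + C 1) - pfPoly n c).IsRoot t} :=
    (Set.Ici_infinite (0 : ℚ)).mono fun t ht => hroot t ht
  have h0 := Polynomial.eq_zero_of_infinite_isRoot _ hinf
  exact sub_eq_zero.1 h0

/-! ### Transport to `ℂ` -/

/-- `aeval z E_p · (z+p+1) = ∏_{i ≤ n} (z+1+i)` over `ℂ`. -/
theorem aeval_polePolyErase_mul (n : ℕ) {p : ℕ} (hp : p ≤ n) (z : ℂ) :
    aeval z (polePolyErase n p) * (z + p + 1) = ∏ i ∈ range (n + 1), (z + 1 + i) := by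
  unfold polePolyErase
  rw [map_prod]
  have hmem : p ∈ range (n + 1) := mem_range.2 (Nat.lt_succ_of_le hp)
  rw [← prod_erase_mul _ _ hmem]
  congr 1
  · refine prod_congr rfl fun i _ => ?_
    rw [map_add, aeval_X, aeval_C, map_add, map_natCast, map_one]
    ring
  · ring

/-- **The summand over `ℂ` equals its partial fractions**: for `b` in the box with `Σ_j b_j ≤ 3b₀ + 1` and
`z ∈ ℂ` with `z + p + 1 ≠ 0` for `p ≤ b₀`,
`Rc b z = Σ_{p ≤ b₀} Σ_{o<6} (pfData b o p) / (z+p+1)^{o+1}`. -/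
theorem Rc_eq_pf (b : ℕ → ℤ) (hb : InBox b) (hsum : ∑ j ∈ range 7, b (j + 1) ≤ 3 * b 0 + 1)
    (z : ℂ) (hz : ∀ p, p ≤ (b 0).toNat → z + p + 1 ≠ 0) :
    Rc b z = ∑ p ∈ range ((b 0).toNat + 1), ∑ o ∈ range 6,
      ((pfData b o p : ℚ) : ℂ) / (z + p + 1) ^ (o + 1) := by
  set n := (b 0).toNat with hn
  obtain ⟨c₀, hc₀⟩ := exists_isPFData b hb hsum
  have hc : IsPFData b (pfData b) := isPFData_pfData hc₀
  have hpoly := numPoly_comp_eq_pfPoly hc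
  -- evaluate the polynomial identity at `z`
  have hev : aeval (z + 1) (numPoly b) = aeval z (pfPoly n (pfData b)) := by
    rw [← hpoly, aeval_comp, map_add, aeval_X, aeval_C, map_one]
  have hD : (∏ i ∈ range (n + 1), (z + 1 + i)) ≠ 0 := by
    refine prod_ne_zero_iff.2 fun i hi => ?_
    have := hz i (Nat.lt_succ_iff.1 (mem_range.1 hi))
    intro h0; exact this (by linear_combination h0)
  unfold Rc
  rw [← hn, hev, pfPoly, map_sum, sum_div]
  refine sum_congr rfl fun p hp => ?_
  have hpn : p ≤ n := Nat.lt_succ_iff.1 (mem_range.1 hp)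
  rw [map_sum, sum_div]
  refine sum_congr rfl fun o ho => ?_
  have ho6 : o < 6 := mem_range.1 ho
  have hu : (z + p + 1 : ℂ) ≠ 0 := hz p hpn
  rw [map_mul, map_mul, aeval_C, eq_ratCast, map_pow, map_pow, map_add, aeval_X, aeval_C, map_add,
    map_natCast, map_one, ← aeval_polePolyErase_mul n hpn z]
  have hE : aeval z (polePolyErase n p) ≠ 0 := by
    intro h0
    apply hD
    rw [← aeval_polePolyErase_mul n hpn z, h0, zero_mul]
  have hsplit : (aeval z (polePolyErase n p) * (z + p + 1)) ^ 6 =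
      aeval z (polePolyErase n p) ^ 6 * ((z + p + 1) ^ (o + 1) * (z + p + 1) ^ (5 - o)) := by
    rw [mul_pow, ← pow_add, show o + 1 + (5 - o) = 6 by omega]
  rw [hsplit, show (z + ((p : ℂ) + 1)) = z + p + 1 by ring]
  field_simp

end Summit.KontsevichZagierPeriods.Zeta5Search.DualPF
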